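/-
Copyright (c) 2026. All rights reserved.
Released under Apache 2.0 license as described in the file LICENSE.
Authors: HodgeCM-Mathlib publication cell (pub/hodgecm-mathlib), floor-0 programme P4, seat F0P4-p06 (S4a lead).
-/
import Literature.NumberTheory.Automorphic.Liu2021.Def411WeilCarriersAtLineClassTransportOfUnramified
import Literature.NumberTheory.GelbartRogawski1991.LocalLineIsometryUnramifiedVector
import HarnessLib

/-!
# [Liu2021, Def. 4.11]: `ω(μ, ε, χ)` at a line depends only on the finite local norm classes of the line — the line-class transport,
# UNCONDITIONAL at the frame `Equiv.prodUnique (Fin N) (Fin 1)`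

Topic `NumberTheory/Automorphic/Liu2021`; namespace `Literature.NumberTheory.Automorphic.Liu2021.Def411WeilCarriers` (sequel of ★
`Def411WeilCarriersAtLineClassTransportOfUnramified`).  THEOREMS ONLY; nothing of [Liu2021] is asserted.  Cell hodgecm-mathlib, crux
H413 (stmt-HodgeConjecture-24833): the MASTER `lineClassTransport_equiv` of stub S4a `StubT3aLineTransportAt` ∕ P2 (C′) ∕ the S5 closer,
at the pin's frame.

* `exists_omegaAtLine_equiv_rhoVAtLine_of_exists_unramifiedVector` — the gluing of ★ `…_of_locF_eq_of_unramifiedVector` restated to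
  consume a GIVEN witness family with the unramified eigenvector property (`∃ x hx, ∀ᶠ v, 𝟙 = c • M_{x_v} 𝟙`);
* **`exists_omegaAtLine_equiv_rhoVAtLine_of_locF_eq`** — UNCONDITIONAL: ★ A-p17's
  `LocalSplitting.exists_localRing_units_lineDelta_eventually_smul_unitVec` (the witnesses `x_v = ι_v p_v + ι_v(q_v a₁)·a₁⁻¹δ` of a
  finite-adèle solution of `p² − δ² q² = a₂⁻¹a₁`, integral a.e., and «implementers of an integral symplectic matrix have `𝟙_{𝒪ᴺ}` as
  eigenvector») supplies that family from `locF a₁ = locF a₂`.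

HC_CM is proved only modulo the printed citations until rung 0 closes; this file proves nothing printed.

## References
* [Liu2021] Y. Liu, Camb. J. Math. 9 (2021) = arXiv:2102.11518: Def. 4.11 (l. 2092–2096), Def. 4.12, App. D §D.1 Step 1 footnote
  (l. 5215), Lemma D.1 (3) (l. 5233).
* [Flath1979] D. Flath, PSPM 33 (1979) part 1, §2 Example 2.
* [MoeglinVignerasWaldspurger1987] C. Mœglin, M.-F. Vignéras, J.-L. Waldspurger, LNM 1291 (1987), Chap. 2 II.1, Chap. 3 I.1–I.3.
* [GelbartRogawski1991] S. Gelbart, J. Rogawski, Invent. Math. 105 (1991), §3.1 Remark p. 457 L4–13.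

ED. 2 (append-only): `exists_omegaAtLine_equiv_rhoVAtLine_of_exists_unramifiedVector'`, `exists_omegaAtLine_equiv_rhoVAtLine_of_locF_eq'` —
the same two theorems for EVERY rank `N` (no `0 < N`), over ★ `lineTransportOp_omegaLoc_localLineInl'`.
-/

set_option autoImplicit false

noncomputable section

open scoped Matrix Kronecker RestrictedProduct
open Filter Function Set NumberField IsDedekindDomain
open Literature.RepresentationTheory.HeisenbergGroup
open Literature.NumberTheory.Automorphic Literature.NumberTheory.Automorphic.UnitaryGroup
open Literature.NumberTheory.Weil1964 Literature.RepresentationTheory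

namespace Literature.NumberTheory.Automorphic.Liu2021.Def411WeilCarriers

open Literature.NumberTheory.GelbartRogawski1991 Literature.NumberTheory.GelbartRogawski1991.UnitaryDualPair
open Literature.NumberTheory.GelbartRogawski1991.UnitaryDualPair.WeilCoinv
open Literature.NumberTheory.GelbartRogawski1991.UnitaryDualPair.LocalSplitting
open Literature.NumberTheory.GelbartRogawski1991.GRConstruction (Fp congrW undoubledSplittings cmFinLocalFamily borelPlaceMeasure)
open Literature.NumberTheory.Automorphic.Liu2021.Def411WeilCarriersDoubling (lineW complexConj_lineW lineW_ne_zero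
  realDiagonal_lineW diagonal_lineW chiSplittingLine isCompatible_chiSplittingLine)
open Literature.NumberTheory.GaloisRepresentations Literature.RepresentationTheory.HarrisKudlaSweet1996

variable (L : Type) [Field L] [NumberField L] [IsCMField L] {N : ℕ} (hN : 0 < N)
  (dV : Fin N → L) (hdV : ∀ i, IsCMField.complexConj L (dV i) = dV i) (hdV0 : ∀ i, dV i ≠ 0)
  (θ : HeckeCharacter L) (hθu : θ.IsUnitary) (hθs : IsSplittingChar L 1 θ)
  (χ : Chi (Fp L) L (IsCMField.complexConj L)) (a₁ a₂ : (Fp L)ˣ)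

-- heartbeats: the statement displays the unramified-vector clause over the two CM local families of record and the
-- line-transport operators (the telescopes of ★ S6a, whose statement alone needs 1 600 000); default 200 000 times out.
set_option maxHeartbeats 3200000 in
include hN in
/-- **the gluing from a GIVEN family of local witnesses with the unramified eigenvector property a.e.** (the `∃ x hx, ∀ᶠ …` shape delivered by ★ `LocalSplitting.exists_localRing_units_lineDelta_eventually_smul_unitVec`):
for lines `a₁, a₂ ∈ (L⁺)ˣ` with the same local norm class at every finite place (`locF L⁺ δ² a₁ = locF L⁺ δ² a₂`), GIVEN that the local
line-transport operators `M_{x_v}` at any family of witnesses `x_v` (`a₂⁻¹δ = x_v x̄_v a₁⁻¹δ`, integral a.e.) fix the unramified vector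
`𝟙_{𝒪_vᴺ}` up to a unit for almost all `v` (`hP3`), the carriers `ω(μ, ε, χ)` at the `θ`-attached splittings of the lines `⟨a₁⟩`, `⟨a₂⟩` are
ISOMORPHIC, `U(diag dV)(𝔸_{L⁺,f})`-equivariantly on the nose: `∃ Ψ, ∀ k x, Ψ (rhoVAtLine … a₁ χ k x) = rhoVAtLine … a₂ χ k (Ψ x)`.
Road (F): local witnesses ★ `exists_localRing_units_lineDelta_eq`; local equivalences ★ `lineTransportOp_omegaLoc_localLineInl`; gluing
★ `IsRestrictedTensorProductRep.exists_equiv_of_forall_equiv` over `⊗'_v (ω_{a,v} ∘ (k ↦ k ⊗ 1))` (§1); Kronecker re-indexing ★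
`finPairRepV_chiSplittingLine_apply`; descent ★ `exists_omegaAtLine_equiv_rhoVAtLine_of_twoLines_V`.
[cite: Liu2021, Def. 4.11 (l. 2092–2096); Def. 4.12; App. D §D.1 Step 1 footnote (l. 5215)] [cite: Flath1979, §2 Example 2]
[cite: MoeglinVignerasWaldspurger1987, Chap. 3 I.1–I.3] [cite: GelbartRogawski1991, §3.1 Remark p. 457 L4–13] -/
theorem exists_omegaAtLine_equiv_rhoVAtLine_of_exists_unramifiedVector
    (hx3 : ∃ (x : ∀ v : HeightOneSpectrum (𝓞 (Fp L)), (LocalRing L v)ˣ)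
      (hx : ∀ v, algebraMap L (LocalRing L v) (algebraMap (Fp L) L (↑a₂⁻¹ : Fp L) * imagUnit L) =
        (x v : LocalRing L v) * conjLocal L (IsCMField.complexConj L) v (x v) *
          algebraMap L (LocalRing L v) (algebraMap (Fp L) L (↑a₁⁻¹ : Fp L) * imagUnit L)),
      ∀ᶠ v in cofinite, ∃ cv : ℂˣ, unitVec (Fp L) (Fin N) v =
        cv • (Literature.RepresentationTheory.MoeglinVignerasWaldspurger1987.lineTransportOp L v (IsCMField.complexConj L) N
          (conj_lineDelta (complexConj_imagUnit L) a₁) (lineDelta_ne_zero (imagUnit_ne_zero L) a₁)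
          (lineDelta_mul_self (imagUnit_mul_self L) a₁) (conj_lineDelta (complexConj_imagUnit L) a₂)
          (lineDelta_ne_zero (imagUnit_ne_zero L) a₂) (lineDelta_mul_self (imagUnit_mul_self L) a₂) (x v)
          (realDiagonal L dV hdV) (realDiagonal_isSymm L dV hdV) (isUnit_det_realDiagonal L dV hdV hdV0) (hx v)) (unitVec (Fp L) (Fin N) v)) :
    ∃ Ψ : omegaAtLine (Fp L) L (IsCMField.complexConj L) N (Equiv.prodUnique (Fin N) (Fin 1)) (Matrix.diagonal dV)
          (complexConj_imagUnit L) (imagUnit_ne_zero L) (imagUnit_mul_self L) (realDiagonal_isSymm L dV hdV)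
          (isUnit_det_realDiagonal L dV hdV hdV0) (realDiagonal_map L dV hdV).symm
          (fun b => isCompatible_chiSplittingLine L (Equiv.prodUnique (Fin N) (Fin 1)) dV hdV hdV0 θ hθu hθs (TW (Fp L) b)
            (isSymm_TW (Fp L) b) (isUnit_det_TW (Fp L) b) (JW (Fp L) L b) (JW_eq (Fp L) L b)) a₁ χ ≃ₗ[ℂ]
        omegaAtLine (Fp L) L (IsCMField.complexConj L) N (Equiv.prodUnique (Fin N) (Fin 1)) (Matrix.diagonal dV)
          (complexConj_imagUnit L) (imagUnit_ne_zero L) (imagUnit_mul_self L) (realDiagonal_isSymm L dV hdV)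
          (isUnit_det_realDiagonal L dV hdV hdV0) (realDiagonal_map L dV hdV).symm
          (fun b => isCompatible_chiSplittingLine L (Equiv.prodUnique (Fin N) (Fin 1)) dV hdV hdV0 θ hθu hθs (TW (Fp L) b)
            (isSymm_TW (Fp L) b) (isUnit_det_TW (Fp L) b) (JW (Fp L) L b) (JW_eq (Fp L) L b)) a₂ χ,
      ∀ (k : finAdelic (Fp L) L (IsCMField.complexConj L) N (Matrix.diagonal dV))
        (y : omegaAtLine (Fp L) L (IsCMField.complexConj L) N (Equiv.prodUnique (Fin N) (Fin 1)) (Matrix.diagonal dV)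
          (complexConj_imagUnit L) (imagUnit_ne_zero L) (imagUnit_mul_self L) (realDiagonal_isSymm L dV hdV)
          (isUnit_det_realDiagonal L dV hdV hdV0) (realDiagonal_map L dV hdV).symm
          (fun b => isCompatible_chiSplittingLine L (Equiv.prodUnique (Fin N) (Fin 1)) dV hdV hdV0 θ hθu hθs (TW (Fp L) b)
            (isSymm_TW (Fp L) b) (isUnit_det_TW (Fp L) b) (JW (Fp L) L b) (JW_eq (Fp L) L b)) a₁ χ),
        Ψ (rhoVAtLine (Fp L) L (IsCMField.complexConj L) N (Equiv.prodUnique (Fin N) (Fin 1)) (Matrix.diagonal dV)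
            (complexConj_imagUnit L) (imagUnit_ne_zero L) (imagUnit_mul_self L) (realDiagonal_isSymm L dV hdV)
            (isUnit_det_realDiagonal L dV hdV hdV0) (realDiagonal_map L dV hdV).symm
            (fun b => isCompatible_chiSplittingLine L (Equiv.prodUnique (Fin N) (Fin 1)) dV hdV hdV0 θ hθu hθs (TW (Fp L) b)
              (isSymm_TW (Fp L) b) (isUnit_det_TW (Fp L) b) (JW (Fp L) L b) (JW_eq (Fp L) L b)) a₁ χ k y) =
          rhoVAtLine (Fp L) L (IsCMField.complexConj L) N (Equiv.prodUnique (Fin N) (Fin 1)) (Matrix.diagonal dV)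
            (complexConj_imagUnit L) (imagUnit_ne_zero L) (imagUnit_mul_self L) (realDiagonal_isSymm L dV hdV)
            (isUnit_det_realDiagonal L dV hdV hdV0) (realDiagonal_map L dV hdV).symm
            (fun b => isCompatible_chiSplittingLine L (Equiv.prodUnique (Fin N) (Fin 1)) dV hdV hdV0 θ hθu hθs (TW (Fp L) b)
              (isSymm_TW (Fp L) b) (isUnit_det_TW (Fp L) b) (JW (Fp L) L b) (JW_eq (Fp L) L b)) a₂ χ k (Ψ y) := by
  classical
  obtain ⟨x, hx, hc⟩ := hx3
  -- the two `⊗'` certificates of `k ↦ Ω_{aᵢ}(reindex (k ⊗ 1))`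
  have h₁ := FinLocalSplittings.isRestrictedTensorProductRep_omegaPi_comp_localLineInl (Equiv.prodUnique (Fin N) (Fin 1))
    (Matrix.diagonal dV) (JW (Fp L) L a₁)
    (congrW L (Equiv.prodUnique (Fin N) (Fin 1)) dV hdV (lineW L (TW (Fp L) a₁)) (complexConj_lineW L (TW (Fp L) a₁))
            (realDiagonal_lineW L (TW (Fp L) a₁)) (diagonal_lineW L (TW (Fp L) a₁) (JW_eq (Fp L) L a₁))
            (undoubledSplittings L (Equiv.prodUnique (Fin N) (Fin 1)) dV hdV hdV0 (lineW L (TW (Fp L) a₁))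
              (complexConj_lineW L (TW (Fp L) a₁)) (lineW_ne_zero L (TW (Fp L) a₁) (isUnit_det_TW (Fp L) a₁)) θ
              (borelPlaceMeasure L)
              (cmFinLocalFamily L (Equiv.prodUnique (Fin N) (Fin 1)) dV hdV hdV0 (lineW L (TW (Fp L) a₁))
                (complexConj_lineW L (TW (Fp L) a₁)) (lineW_ne_zero L (TW (Fp L) a₁) (isUnit_det_TW (Fp L) a₁)) θ hθs
                (borelPlaceMeasure L)))
            (isSymm_TW (Fp L) a₁) (JW_eq (Fp L) L a₁))
  have h₂ := FinLocalSplittings.isRestrictedTensorProductRep_omegaPi_comp_localLineInl (Equiv.prodUnique (Fin N) (Fin 1))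
    (Matrix.diagonal dV) (JW (Fp L) L a₂)
    (congrW L (Equiv.prodUnique (Fin N) (Fin 1)) dV hdV (lineW L (TW (Fp L) a₂)) (complexConj_lineW L (TW (Fp L) a₂))
            (realDiagonal_lineW L (TW (Fp L) a₂)) (diagonal_lineW L (TW (Fp L) a₂) (JW_eq (Fp L) L a₂))
            (undoubledSplittings L (Equiv.prodUnique (Fin N) (Fin 1)) dV hdV hdV0 (lineW L (TW (Fp L) a₂))
              (complexConj_lineW L (TW (Fp L) a₂)) (lineW_ne_zero L (TW (Fp L) a₂) (isUnit_det_TW (Fp L) a₂)) θ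
              (borelPlaceMeasure L)
              (cmFinLocalFamily L (Equiv.prodUnique (Fin N) (Fin 1)) dV hdV hdV0 (lineW L (TW (Fp L) a₂))
                (complexConj_lineW L (TW (Fp L) a₂)) (lineW_ne_zero L (TW (Fp L) a₂) (isUnit_det_TW (Fp L) a₂)) θ hθs
                (borelPlaceMeasure L)))
            (isSymm_TW (Fp L) a₂) (JW_eq (Fp L) L a₂))
  -- Flath gluing of the local equivalences `M_{x_v}`
  obtain ⟨E, hE⟩ := IsRestrictedTensorProductRep.exists_equiv_of_forall_equiv h₁ h₂
    (fun v => (Literature.RepresentationTheory.MoeglinVignerasWaldspurger1987.lineTransportOp L v (IsCMField.complexConj L) N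
          (conj_lineDelta (complexConj_imagUnit L) a₁) (lineDelta_ne_zero (imagUnit_ne_zero L) a₁)
          (lineDelta_mul_self (imagUnit_mul_self L) a₁) (conj_lineDelta (complexConj_imagUnit L) a₂)
          (lineDelta_ne_zero (imagUnit_ne_zero L) a₂) (lineDelta_mul_self (imagUnit_mul_self L) a₂) (x v)
          (realDiagonal L dV hdV) (realDiagonal_isSymm L dV hdV) (isUnit_det_realDiagonal L dV hdV hdV0) (hx v)))
    (fun v g Φ => lineTransportOp_omegaLoc_localLineInl L dV hdV hdV0 v hN θ hθs a₁ a₂ (x v) (hx v) g Φ) hc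
  -- conjugate by the Kronecker re-indexing `R` and descend by (T0′)
  refine (exists_omegaAtLine_equiv_rhoVAtLine_of_twoLines_V (Fp L) L (IsCMField.complexConj L) N
    (Equiv.prodUnique (Fin N) (Fin 1)) (Matrix.diagonal dV) (complexConj_imagUnit L) (imagUnit_ne_zero L)
    (imagUnit_mul_self L) (realDiagonal_isSymm L dV hdV) (isUnit_det_realDiagonal L dV hdV hdV0) (realDiagonal_map L dV hdV).symm
    (fun b => isCompatible_chiSplittingLine L (Equiv.prodUnique (Fin N) (Fin 1)) dV hdV hdV0 θ hθu hθs (TW (Fp L) b)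
      (isSymm_TW (Fp L) b) (isUnit_det_TW (Fp L) b) (JW (Fp L) L b) (JW_eq (Fp L) L b)) a₁ a₂ χ
    ((finSBReindex (Fp L) (Equiv.prodUnique (Fin N) (Fin 1))).trans
      (E.trans (finSBReindex (Fp L) (Equiv.prodUnique (Fin N) (Fin 1))).symm)) (fun k f => ?_)).imp
    fun Ψ h => fun k y => (h.2 k y).symm
  simp only [LinearEquiv.trans_apply, finPairRepV_chiSplittingLine_apply, LinearEquiv.apply_symm_apply]
  rw [FinLocalSplittings.Omega_finPairEmb_inl, FinLocalSplittings.Omega_finPairEmb_inl]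
  exact congrArg (finSBReindex (Fp L) (Equiv.prodUnique (Fin N) (Fin 1))).symm
    (LinearMap.congr_fun (hE (finAdelicEquiv (Fp L) L (IsCMField.complexConj L) N (Matrix.diagonal dV) k))
      (finSBReindex (Fp L) (Equiv.prodUnique (Fin N) (Fin 1)) f)).symm


-- heartbeats: as above (the statement spells the two CM local families through `omegaAtLine`∕`rhoVAtLine`).
set_option maxHeartbeats 3200000 in
include hN in
/-- **[Liu2021, Def. 4.11 ∕ App. D §D.1 Step 1 footnote l. 5215] — THE LINE-CLASS TRANSPORT at the frame `Equiv.prodUnique (Fin N) (Fin 1)`,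
UNCONDITIONAL:** for a CM field `L`, a real frame `dV` (rank `N ≥ 1`), a unitary splitting character `θ`, `χ ∈ Chi`, and lines
`a₁, a₂ ∈ (L⁺)ˣ` with `locF L⁺ δ² a₁ = locF L⁺ δ² a₂` (the same norm class at EVERY FINITE place), the carriers `ω(μ, ε, χ)` at the
`θ`-attached splittings of `⟨a₁⟩` and `⟨a₂⟩` are isomorphic `U(diag dV)(𝔸_{L⁺,f})`-equivariantly ON THE NOSE:
`∃ Ψ : omegaAtLine … a₁ χ ≃ₗ[ℂ] omegaAtLine … a₂ χ, ∀ k x, Ψ (rhoVAtLine … a₁ χ k x) = rhoVAtLine … a₂ χ k (Ψ x)`.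
Assembly of road (F): the local witnesses with the unramified eigenvector property ★
`LocalSplitting.exists_localRing_units_lineDelta_eventually_smul_unitVec` (A-p17), the local intertwiners ★
`lineTransportOp_omegaLoc_localLineInl`, Flath gluing, Kronecker re-indexing and the (T0′) descent
(`exists_omegaAtLine_equiv_rhoVAtLine_of_exists_unramifiedVector`).  The cell's stub S4a `StubT3aLineTransportAt` at the pin's frame
`ArchSideTerm.e₁ = Equiv.prodUnique (Fin 3) (Fin 1)` and P2's (C′) at that frame are instances; the frame-general letters follow by the
`e`-reindex transport.
[cite: Liu2021, Def. 4.11 (l. 2092–2096); Def. 4.12; App. D §D.1 Step 1 footnote (l. 5215); Lemma D.1 (3) (l. 5233)]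
[cite: Flath1979, §2 Example 2] [cite: MoeglinVignerasWaldspurger1987, Chap. 3 I.1–I.3] [cite: GelbartRogawski1991, §3.1 Remark p. 457 L4–13] -/
theorem exists_omegaAtLine_equiv_rhoVAtLine_of_locF_eq
    (hloc : locF (Fp L) (imagUnitSq L) a₁ = locF (Fp L) (imagUnitSq L) a₂) :
    ∃ Ψ : omegaAtLine (Fp L) L (IsCMField.complexConj L) N (Equiv.prodUnique (Fin N) (Fin 1)) (Matrix.diagonal dV)
          (complexConj_imagUnit L) (imagUnit_ne_zero L) (imagUnit_mul_self L) (realDiagonal_isSymm L dV hdV)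
          (isUnit_det_realDiagonal L dV hdV hdV0) (realDiagonal_map L dV hdV).symm
          (fun b => isCompatible_chiSplittingLine L (Equiv.prodUnique (Fin N) (Fin 1)) dV hdV hdV0 θ hθu hθs (TW (Fp L) b)
            (isSymm_TW (Fp L) b) (isUnit_det_TW (Fp L) b) (JW (Fp L) L b) (JW_eq (Fp L) L b)) a₁ χ ≃ₗ[ℂ]
        omegaAtLine (Fp L) L (IsCMField.complexConj L) N (Equiv.prodUnique (Fin N) (Fin 1)) (Matrix.diagonal dV)
          (complexConj_imagUnit L) (imagUnit_ne_zero L) (imagUnit_mul_self L) (realDiagonal_isSymm L dV hdV)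
          (isUnit_det_realDiagonal L dV hdV hdV0) (realDiagonal_map L dV hdV).symm
          (fun b => isCompatible_chiSplittingLine L (Equiv.prodUnique (Fin N) (Fin 1)) dV hdV hdV0 θ hθu hθs (TW (Fp L) b)
            (isSymm_TW (Fp L) b) (isUnit_det_TW (Fp L) b) (JW (Fp L) L b) (JW_eq (Fp L) L b)) a₂ χ,
      ∀ (k : finAdelic (Fp L) L (IsCMField.complexConj L) N (Matrix.diagonal dV))
        (y : omegaAtLine (Fp L) L (IsCMField.complexConj L) N (Equiv.prodUnique (Fin N) (Fin 1)) (Matrix.diagonal dV)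
          (complexConj_imagUnit L) (imagUnit_ne_zero L) (imagUnit_mul_self L) (realDiagonal_isSymm L dV hdV)
          (isUnit_det_realDiagonal L dV hdV hdV0) (realDiagonal_map L dV hdV).symm
          (fun b => isCompatible_chiSplittingLine L (Equiv.prodUnique (Fin N) (Fin 1)) dV hdV hdV0 θ hθu hθs (TW (Fp L) b)
            (isSymm_TW (Fp L) b) (isUnit_det_TW (Fp L) b) (JW (Fp L) L b) (JW_eq (Fp L) L b)) a₁ χ),
        Ψ (rhoVAtLine (Fp L) L (IsCMField.complexConj L) N (Equiv.prodUnique (Fin N) (Fin 1)) (Matrix.diagonal dV)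
            (complexConj_imagUnit L) (imagUnit_ne_zero L) (imagUnit_mul_self L) (realDiagonal_isSymm L dV hdV)
            (isUnit_det_realDiagonal L dV hdV hdV0) (realDiagonal_map L dV hdV).symm
            (fun b => isCompatible_chiSplittingLine L (Equiv.prodUnique (Fin N) (Fin 1)) dV hdV hdV0 θ hθu hθs (TW (Fp L) b)
              (isSymm_TW (Fp L) b) (isUnit_det_TW (Fp L) b) (JW (Fp L) L b) (JW_eq (Fp L) L b)) a₁ χ k y) =
          rhoVAtLine (Fp L) L (IsCMField.complexConj L) N (Equiv.prodUnique (Fin N) (Fin 1)) (Matrix.diagonal dV)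
            (complexConj_imagUnit L) (imagUnit_ne_zero L) (imagUnit_mul_self L) (realDiagonal_isSymm L dV hdV)
            (isUnit_det_realDiagonal L dV hdV hdV0) (realDiagonal_map L dV hdV).symm
            (fun b => isCompatible_chiSplittingLine L (Equiv.prodUnique (Fin N) (Fin 1)) dV hdV hdV0 θ hθu hθs (TW (Fp L) b)
              (isSymm_TW (Fp L) b) (isUnit_det_TW (Fp L) b) (JW (Fp L) L b) (JW_eq (Fp L) L b)) a₂ χ k (Ψ y) :=
  exists_omegaAtLine_equiv_rhoVAtLine_of_exists_unramifiedVector L hN dV hdV hdV0 θ hθu hθs χ a₁ a₂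
    (LocalSplitting.exists_localRing_units_lineDelta_eventually_smul_unitVec L (IsCMField.complexConj L) N
      (complexConj_imagUnit L) (imagUnit_ne_zero L) (imagUnit_mul_self L) (realDiagonal L dV hdV) (realDiagonal_isSymm L dV hdV)
      (isUnit_det_realDiagonal L dV hdV hdV0) a₁ a₂ fun v => congr_fun hloc v)


/-! ## ED. 2 — every rank `N` (the hypothesis `0 < N` removed) -/

-- heartbeats: as above.
set_option maxHeartbeats 3200000 in
/-- **ED. 2 — the gluing from a GIVEN family of local witnesses with the unramified eigenvector property a.e., EVERY RANK `N`** (no `0 < N`: the local intertwiners are ★ `lineTransportOp_omegaLoc_localLineInl'`, trivial in rank `0`) (the `∃ x hx, ∀ᶠ …` shape delivered by ★ `LocalSplitting.exists_localRing_units_lineDelta_eventually_smul_unitVec`):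
for lines `a₁, a₂ ∈ (L⁺)ˣ` with the same local norm class at every finite place (`locF L⁺ δ² a₁ = locF L⁺ δ² a₂`), GIVEN that the local
line-transport operators `M_{x_v}` at any family of witnesses `x_v` (`a₂⁻¹δ = x_v x̄_v a₁⁻¹δ`, integral a.e.) fix the unramified vector
`𝟙_{𝒪_vᴺ}` up to a unit for almost all `v` (`hP3`), the carriers `ω(μ, ε, χ)` at the `θ`-attached splittings of the lines `⟨a₁⟩`, `⟨a₂⟩` are
ISOMORPHIC, `U(diag dV)(𝔸_{L⁺,f})`-equivariantly on the nose: `∃ Ψ, ∀ k x, Ψ (rhoVAtLine … a₁ χ k x) = rhoVAtLine … a₂ χ k (Ψ x)`.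
Road (F): local witnesses ★ `exists_localRing_units_lineDelta_eq`; local equivalences ★ `lineTransportOp_omegaLoc_localLineInl`; gluing
★ `IsRestrictedTensorProductRep.exists_equiv_of_forall_equiv` over `⊗'_v (ω_{a,v} ∘ (k ↦ k ⊗ 1))` (§1); Kronecker re-indexing ★
`finPairRepV_chiSplittingLine_apply`; descent ★ `exists_omegaAtLine_equiv_rhoVAtLine_of_twoLines_V`.
[cite: Liu2021, Def. 4.11 (l. 2092–2096); Def. 4.12; App. D §D.1 Step 1 footnote (l. 5215)] [cite: Flath1979, §2 Example 2]
[cite: MoeglinVignerasWaldspurger1987, Chap. 3 I.1–I.3] [cite: GelbartRogawski1991, §3.1 Remark p. 457 L4–13] -/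
theorem exists_omegaAtLine_equiv_rhoVAtLine_of_exists_unramifiedVector'
    (hx3 : ∃ (x : ∀ v : HeightOneSpectrum (𝓞 (Fp L)), (LocalRing L v)ˣ)
      (hx : ∀ v, algebraMap L (LocalRing L v) (algebraMap (Fp L) L (↑a₂⁻¹ : Fp L) * imagUnit L) =
        (x v : LocalRing L v) * conjLocal L (IsCMField.complexConj L) v (x v) *
          algebraMap L (LocalRing L v) (algebraMap (Fp L) L (↑a₁⁻¹ : Fp L) * imagUnit L)),
      ∀ᶠ v in cofinite, ∃ cv : ℂˣ, unitVec (Fp L) (Fin N) v =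
        cv • (Literature.RepresentationTheory.MoeglinVignerasWaldspurger1987.lineTransportOp L v (IsCMField.complexConj L) N
          (conj_lineDelta (complexConj_imagUnit L) a₁) (lineDelta_ne_zero (imagUnit_ne_zero L) a₁)
          (lineDelta_mul_self (imagUnit_mul_self L) a₁) (conj_lineDelta (complexConj_imagUnit L) a₂)
          (lineDelta_ne_zero (imagUnit_ne_zero L) a₂) (lineDelta_mul_self (imagUnit_mul_self L) a₂) (x v)
          (realDiagonal L dV hdV) (realDiagonal_isSymm L dV hdV) (isUnit_det_realDiagonal L dV hdV hdV0) (hx v)) (unitVec (Fp L) (Fin N) v)) :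
    ∃ Ψ : omegaAtLine (Fp L) L (IsCMField.complexConj L) N (Equiv.prodUnique (Fin N) (Fin 1)) (Matrix.diagonal dV)
          (complexConj_imagUnit L) (imagUnit_ne_zero L) (imagUnit_mul_self L) (realDiagonal_isSymm L dV hdV)
          (isUnit_det_realDiagonal L dV hdV hdV0) (realDiagonal_map L dV hdV).symm
          (fun b => isCompatible_chiSplittingLine L (Equiv.prodUnique (Fin N) (Fin 1)) dV hdV hdV0 θ hθu hθs (TW (Fp L) b)
            (isSymm_TW (Fp L) b) (isUnit_det_TW (Fp L) b) (JW (Fp L) L b) (JW_eq (Fp L) L b)) a₁ χ ≃ₗ[ℂ]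
        omegaAtLine (Fp L) L (IsCMField.complexConj L) N (Equiv.prodUnique (Fin N) (Fin 1)) (Matrix.diagonal dV)
          (complexConj_imagUnit L) (imagUnit_ne_zero L) (imagUnit_mul_self L) (realDiagonal_isSymm L dV hdV)
          (isUnit_det_realDiagonal L dV hdV hdV0) (realDiagonal_map L dV hdV).symm
          (fun b => isCompatible_chiSplittingLine L (Equiv.prodUnique (Fin N) (Fin 1)) dV hdV hdV0 θ hθu hθs (TW (Fp L) b)
            (isSymm_TW (Fp L) b) (isUnit_det_TW (Fp L) b) (JW (Fp L) L b) (JW_eq (Fp L) L b)) a₂ χ,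
      ∀ (k : finAdelic (Fp L) L (IsCMField.complexConj L) N (Matrix.diagonal dV))
        (y : omegaAtLine (Fp L) L (IsCMField.complexConj L) N (Equiv.prodUnique (Fin N) (Fin 1)) (Matrix.diagonal dV)
          (complexConj_imagUnit L) (imagUnit_ne_zero L) (imagUnit_mul_self L) (realDiagonal_isSymm L dV hdV)
          (isUnit_det_realDiagonal L dV hdV hdV0) (realDiagonal_map L dV hdV).symm
          (fun b => isCompatible_chiSplittingLine L (Equiv.prodUnique (Fin N) (Fin 1)) dV hdV hdV0 θ hθu hθs (TW (Fp L) b)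
            (isSymm_TW (Fp L) b) (isUnit_det_TW (Fp L) b) (JW (Fp L) L b) (JW_eq (Fp L) L b)) a₁ χ),
        Ψ (rhoVAtLine (Fp L) L (IsCMField.complexConj L) N (Equiv.prodUnique (Fin N) (Fin 1)) (Matrix.diagonal dV)
            (complexConj_imagUnit L) (imagUnit_ne_zero L) (imagUnit_mul_self L) (realDiagonal_isSymm L dV hdV)
            (isUnit_det_realDiagonal L dV hdV hdV0) (realDiagonal_map L dV hdV).symm
            (fun b => isCompatible_chiSplittingLine L (Equiv.prodUnique (Fin N) (Fin 1)) dV hdV hdV0 θ hθu hθs (TW (Fp L) b)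
              (isSymm_TW (Fp L) b) (isUnit_det_TW (Fp L) b) (JW (Fp L) L b) (JW_eq (Fp L) L b)) a₁ χ k y) =
          rhoVAtLine (Fp L) L (IsCMField.complexConj L) N (Equiv.prodUnique (Fin N) (Fin 1)) (Matrix.diagonal dV)
            (complexConj_imagUnit L) (imagUnit_ne_zero L) (imagUnit_mul_self L) (realDiagonal_isSymm L dV hdV)
            (isUnit_det_realDiagonal L dV hdV hdV0) (realDiagonal_map L dV hdV).symm
            (fun b => isCompatible_chiSplittingLine L (Equiv.prodUnique (Fin N) (Fin 1)) dV hdV hdV0 θ hθu hθs (TW (Fp L) b)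
              (isSymm_TW (Fp L) b) (isUnit_det_TW (Fp L) b) (JW (Fp L) L b) (JW_eq (Fp L) L b)) a₂ χ k (Ψ y) := by
  classical
  obtain ⟨x, hx, hc⟩ := hx3
  -- the two `⊗'` certificates of `k ↦ Ω_{aᵢ}(reindex (k ⊗ 1))`
  have h₁ := FinLocalSplittings.isRestrictedTensorProductRep_omegaPi_comp_localLineInl (Equiv.prodUnique (Fin N) (Fin 1))
    (Matrix.diagonal dV) (JW (Fp L) L a₁)
    (congrW L (Equiv.prodUnique (Fin N) (Fin 1)) dV hdV (lineW L (TW (Fp L) a₁)) (complexConj_lineW L (TW (Fp L) a₁))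
            (realDiagonal_lineW L (TW (Fp L) a₁)) (diagonal_lineW L (TW (Fp L) a₁) (JW_eq (Fp L) L a₁))
            (undoubledSplittings L (Equiv.prodUnique (Fin N) (Fin 1)) dV hdV hdV0 (lineW L (TW (Fp L) a₁))
              (complexConj_lineW L (TW (Fp L) a₁)) (lineW_ne_zero L (TW (Fp L) a₁) (isUnit_det_TW (Fp L) a₁)) θ
              (borelPlaceMeasure L)
              (cmFinLocalFamily L (Equiv.prodUnique (Fin N) (Fin 1)) dV hdV hdV0 (lineW L (TW (Fp L) a₁))
                (complexConj_lineW L (TW (Fp L) a₁)) (lineW_ne_zero L (TW (Fp L) a₁) (isUnit_det_TW (Fp L) a₁)) θ hθs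
                (borelPlaceMeasure L)))
            (isSymm_TW (Fp L) a₁) (JW_eq (Fp L) L a₁))
  have h₂ := FinLocalSplittings.isRestrictedTensorProductRep_omegaPi_comp_localLineInl (Equiv.prodUnique (Fin N) (Fin 1))
    (Matrix.diagonal dV) (JW (Fp L) L a₂)
    (congrW L (Equiv.prodUnique (Fin N) (Fin 1)) dV hdV (lineW L (TW (Fp L) a₂)) (complexConj_lineW L (TW (Fp L) a₂))
            (realDiagonal_lineW L (TW (Fp L) a₂)) (diagonal_lineW L (TW (Fp L) a₂) (JW_eq (Fp L) L a₂))
            (undoubledSplittings L (Equiv.prodUnique (Fin N) (Fin 1)) dV hdV hdV0 (lineW L (TW (Fp L) a₂))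
              (complexConj_lineW L (TW (Fp L) a₂)) (lineW_ne_zero L (TW (Fp L) a₂) (isUnit_det_TW (Fp L) a₂)) θ
              (borelPlaceMeasure L)
              (cmFinLocalFamily L (Equiv.prodUnique (Fin N) (Fin 1)) dV hdV hdV0 (lineW L (TW (Fp L) a₂))
                (complexConj_lineW L (TW (Fp L) a₂)) (lineW_ne_zero L (TW (Fp L) a₂) (isUnit_det_TW (Fp L) a₂)) θ hθs
                (borelPlaceMeasure L)))
            (isSymm_TW (Fp L) a₂) (JW_eq (Fp L) L a₂))
  -- Flath gluing of the local equivalences `M_{x_v}`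
  obtain ⟨E, hE⟩ := IsRestrictedTensorProductRep.exists_equiv_of_forall_equiv h₁ h₂
    (fun v => (Literature.RepresentationTheory.MoeglinVignerasWaldspurger1987.lineTransportOp L v (IsCMField.complexConj L) N
          (conj_lineDelta (complexConj_imagUnit L) a₁) (lineDelta_ne_zero (imagUnit_ne_zero L) a₁)
          (lineDelta_mul_self (imagUnit_mul_self L) a₁) (conj_lineDelta (complexConj_imagUnit L) a₂)
          (lineDelta_ne_zero (imagUnit_ne_zero L) a₂) (lineDelta_mul_self (imagUnit_mul_self L) a₂) (x v)
          (realDiagonal L dV hdV) (realDiagonal_isSymm L dV hdV) (isUnit_det_realDiagonal L dV hdV hdV0) (hx v)))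
    (fun v g Φ => lineTransportOp_omegaLoc_localLineInl' L dV hdV hdV0 v θ hθs a₁ a₂ (x v) (hx v) g Φ) hc
  -- conjugate by the Kronecker re-indexing `R` and descend by (T0′)
  refine (exists_omegaAtLine_equiv_rhoVAtLine_of_twoLines_V (Fp L) L (IsCMField.complexConj L) N
    (Equiv.prodUnique (Fin N) (Fin 1)) (Matrix.diagonal dV) (complexConj_imagUnit L) (imagUnit_ne_zero L)
    (imagUnit_mul_self L) (realDiagonal_isSymm L dV hdV) (isUnit_det_realDiagonal L dV hdV hdV0) (realDiagonal_map L dV hdV).symm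
    (fun b => isCompatible_chiSplittingLine L (Equiv.prodUnique (Fin N) (Fin 1)) dV hdV hdV0 θ hθu hθs (TW (Fp L) b)
      (isSymm_TW (Fp L) b) (isUnit_det_TW (Fp L) b) (JW (Fp L) L b) (JW_eq (Fp L) L b)) a₁ a₂ χ
    ((finSBReindex (Fp L) (Equiv.prodUnique (Fin N) (Fin 1))).trans
      (E.trans (finSBReindex (Fp L) (Equiv.prodUnique (Fin N) (Fin 1))).symm)) (fun k f => ?_)).imp
    fun Ψ h => fun k y => (h.2 k y).symm
  simp only [LinearEquiv.trans_apply, finPairRepV_chiSplittingLine_apply, LinearEquiv.apply_symm_apply]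
  rw [FinLocalSplittings.Omega_finPairEmb_inl, FinLocalSplittings.Omega_finPairEmb_inl]
  exact congrArg (finSBReindex (Fp L) (Equiv.prodUnique (Fin N) (Fin 1))).symm
    (LinearMap.congr_fun (hE (finAdelicEquiv (Fp L) L (IsCMField.complexConj L) N (Matrix.diagonal dV) k))
      (finSBReindex (Fp L) (Equiv.prodUnique (Fin N) (Fin 1)) f)).symm


-- heartbeats: as above.
set_option maxHeartbeats 3200000 in
/-- **[Liu2021, Def. 4.11 ∕ App. D §D.1 Step 1 footnote l. 5215] — ED. 2: THE LINE-CLASS TRANSPORT at the frame `Equiv.prodUnique (Fin N) (Fin 1)`,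
UNCONDITIONAL, EVERY RANK `N`** (the rank hypothesis `0 < N` of `…_of_locF_eq` REMOVED — the form consumed by P2's socket (C′), which quantifies over all ranks): for a CM field `L`, a real frame `dV` (any rank `N`), a unitary splitting character `θ`, `χ ∈ Chi`, and lines
`a₁, a₂ ∈ (L⁺)ˣ` with `locF L⁺ δ² a₁ = locF L⁺ δ² a₂` (the same norm class at EVERY FINITE place), the carriers `ω(μ, ε, χ)` at the
`θ`-attached splittings of `⟨a₁⟩` and `⟨a₂⟩` are isomorphic `U(diag dV)(𝔸_{L⁺,f})`-equivariantly ON THE NOSE: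
`∃ Ψ : omegaAtLine … a₁ χ ≃ₗ[ℂ] omegaAtLine … a₂ χ, ∀ k x, Ψ (rhoVAtLine … a₁ χ k x) = rhoVAtLine … a₂ χ k (Ψ x)`.
Assembly of road (F): the local witnesses with the unramified eigenvector property ★
`LocalSplitting.exists_localRing_units_lineDelta_eventually_smul_unitVec` (A-p17), the local intertwiners ★
`lineTransportOp_omegaLoc_localLineInl`, Flath gluing, Kronecker re-indexing and the (T0′) descent
(`exists_omegaAtLine_equiv_rhoVAtLine_of_exists_unramifiedVector'`).  The cell's stub S4a `StubT3aLineTransportAt` at the pin's frame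
`ArchSideTerm.e₁ = Equiv.prodUnique (Fin 3) (Fin 1)` and P2's (C′) at that frame are instances; the frame-general letters follow by the
`e`-reindex transport.
[cite: Liu2021, Def. 4.11 (l. 2092–2096); Def. 4.12; App. D §D.1 Step 1 footnote (l. 5215); Lemma D.1 (3) (l. 5233)]
[cite: Flath1979, §2 Example 2] [cite: MoeglinVignerasWaldspurger1987, Chap. 3 I.1–I.3] [cite: GelbartRogawski1991, §3.1 Remark p. 457 L4–13] -/
theorem exists_omegaAtLine_equiv_rhoVAtLine_of_locF_eq'
    (hloc : locF (Fp L) (imagUnitSq L) a₁ = locF (Fp L) (imagUnitSq L) a₂) :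
    ∃ Ψ : omegaAtLine (Fp L) L (IsCMField.complexConj L) N (Equiv.prodUnique (Fin N) (Fin 1)) (Matrix.diagonal dV)
          (complexConj_imagUnit L) (imagUnit_ne_zero L) (imagUnit_mul_self L) (realDiagonal_isSymm L dV hdV)
          (isUnit_det_realDiagonal L dV hdV hdV0) (realDiagonal_map L dV hdV).symm
          (fun b => isCompatible_chiSplittingLine L (Equiv.prodUnique (Fin N) (Fin 1)) dV hdV hdV0 θ hθu hθs (TW (Fp L) b)
            (isSymm_TW (Fp L) b) (isUnit_det_TW (Fp L) b) (JW (Fp L) L b) (JW_eq (Fp L) L b)) a₁ χ ≃ₗ[ℂ]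
        omegaAtLine (Fp L) L (IsCMField.complexConj L) N (Equiv.prodUnique (Fin N) (Fin 1)) (Matrix.diagonal dV)
          (complexConj_imagUnit L) (imagUnit_ne_zero L) (imagUnit_mul_self L) (realDiagonal_isSymm L dV hdV)
          (isUnit_det_realDiagonal L dV hdV hdV0) (realDiagonal_map L dV hdV).symm
          (fun b => isCompatible_chiSplittingLine L (Equiv.prodUnique (Fin N) (Fin 1)) dV hdV hdV0 θ hθu hθs (TW (Fp L) b)
            (isSymm_TW (Fp L) b) (isUnit_det_TW (Fp L) b) (JW (Fp L) L b) (JW_eq (Fp L) L b)) a₂ χ,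
      ∀ (k : finAdelic (Fp L) L (IsCMField.complexConj L) N (Matrix.diagonal dV))
        (y : omegaAtLine (Fp L) L (IsCMField.complexConj L) N (Equiv.prodUnique (Fin N) (Fin 1)) (Matrix.diagonal dV)
          (complexConj_imagUnit L) (imagUnit_ne_zero L) (imagUnit_mul_self L) (realDiagonal_isSymm L dV hdV)
          (isUnit_det_realDiagonal L dV hdV hdV0) (realDiagonal_map L dV hdV).symm
          (fun b => isCompatible_chiSplittingLine L (Equiv.prodUnique (Fin N) (Fin 1)) dV hdV hdV0 θ hθu hθs (TW (Fp L) b)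
            (isSymm_TW (Fp L) b) (isUnit_det_TW (Fp L) b) (JW (Fp L) L b) (JW_eq (Fp L) L b)) a₁ χ),
        Ψ (rhoVAtLine (Fp L) L (IsCMField.complexConj L) N (Equiv.prodUnique (Fin N) (Fin 1)) (Matrix.diagonal dV)
            (complexConj_imagUnit L) (imagUnit_ne_zero L) (imagUnit_mul_self L) (realDiagonal_isSymm L dV hdV)
            (isUnit_det_realDiagonal L dV hdV hdV0) (realDiagonal_map L dV hdV).symm
            (fun b => isCompatible_chiSplittingLine L (Equiv.prodUnique (Fin N) (Fin 1)) dV hdV hdV0 θ hθu hθs (TW (Fp L) b)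
              (isSymm_TW (Fp L) b) (isUnit_det_TW (Fp L) b) (JW (Fp L) L b) (JW_eq (Fp L) L b)) a₁ χ k y) =
          rhoVAtLine (Fp L) L (IsCMField.complexConj L) N (Equiv.prodUnique (Fin N) (Fin 1)) (Matrix.diagonal dV)
            (complexConj_imagUnit L) (imagUnit_ne_zero L) (imagUnit_mul_self L) (realDiagonal_isSymm L dV hdV)
            (isUnit_det_realDiagonal L dV hdV hdV0) (realDiagonal_map L dV hdV).symm
            (fun b => isCompatible_chiSplittingLine L (Equiv.prodUnique (Fin N) (Fin 1)) dV hdV hdV0 θ hθu hθs (TW (Fp L) b)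
              (isSymm_TW (Fp L) b) (isUnit_det_TW (Fp L) b) (JW (Fp L) L b) (JW_eq (Fp L) L b)) a₂ χ k (Ψ y) :=
  exists_omegaAtLine_equiv_rhoVAtLine_of_exists_unramifiedVector' L dV hdV hdV0 θ hθu hθs χ a₁ a₂
    (LocalSplitting.exists_localRing_units_lineDelta_eventually_smul_unitVec L (IsCMField.complexConj L) N
      (complexConj_imagUnit L) (imagUnit_ne_zero L) (imagUnit_mul_self L) (realDiagonal L dV hdV) (realDiagonal_isSymm L dV hdV)
      (isUnit_det_realDiagonal L dV hdV hdV0) a₁ a₂ fun v => congr_fun hloc v)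

end Literature.NumberTheory.Automorphic.Liu2021.Def411WeilCarriers

end
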